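import Literature.Computability.Cryptography.RegevReductionTT
import Literature.Algebra.EuclideanLattices.ARVerifierMachineValue
import Literature.Computability.Complexity.SelectBricks
import HarnessLib

/-!
# Regev's quantum reduction, `GapSVP` form, IV: the classical pre- and post-processors of Lemma 3.20

Topic `Computability/Cryptography` (family `pqc`). Machine-level piece of the proof of hypothesis `hL`
(Regev 2009, Lemma 3.20 in machine form) of `regev_lwe_to_gapSVP_quantum_of_dgs` (`RegevReduction.lean`):
"a polynomial time reduction from `GapCVP′_{100√n γ(n)}` to `DGS_{√n γ(n)/λ₁(L*)}` … call the `DGS`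
oracle `N` times … apply the verifier `𝒱` of Aharonov–Regev … accept iff it rejects" (author's version
arXiv:2401.03703, p. 22). The quantum assembly (`RegevReductionLemma320.lean`) runs `N = nSamples n`
indexed copies (`PolyCopiesIdx`) of the classically wrapped sampler (`CWrap`) and post-processes the
measured string; this file supplies the three CLASSICAL string functions of that assembly, in `FP`,
with their values:

* `qIn = RegevQuery.queryF ∘ fstF` — on the indexed input `⟨x, eⱼ⟩` of copy `j`, the `DGS` query
  (the code of `(⟨n, (adj(−B))ᵀ⟩, |det B|/(100 d))`, `RegevDualQueryMachine.lean`), the index ignored;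
* `gIn ⟨⟨x, eⱼ⟩, y⟩ = ⟨fstF y, ε⟩` — the sampler's raw vector code, framed (so that it can be read back
  off the block of the copy whatever follows it: `fstF (⟨c, ε⟩ ++ s) = c`, `fstF_frame_append`);
* `blocksF P ⟨x, Y⟩` — the coded list of the `N` strings `fstF (chunk j of Y)`, chunk `j` being the
  `b`-bit window of block `j` of the indexed-copies layout of `P` (`PolyCopiesIdx.blk`), and
  `gOut P = ARMachine.verdictF ∘ ⟨fstF, blocksF P⟩` — the verdict of the Aharonov–Regev verifier on the
  vectors decoded from those strings (`ARVerifierMachineValue.lean`): `gOut_eq_true_iff` /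
  `gOut_eq_false_iff`.

Everything is proved; no named facts.

## References

* O. Regev, *On lattices, learning with errors, random linear codes, and cryptography*, J. ACM 56
  (2009), art. 34; author's version arXiv:2401.03703, Lemma 3.20 and its proof (p. 22). [Regev2009]
* S. Arora, B. Barak, *Computational Complexity: A Modern Approach*, CUP 2009, §1.3. [AroraBarak2009]
-/

noncomputable section

namespace Literature.Computability.Cryptography

namespace Regev2009

namespace Lemma320

open _root_.Computability Polynomial Complexity Complexity.Brick Plumb QuantumComplexity GMSSParallel
  Literature.Algebra.EuclideanLattices Literature.Algebra.EuclideanLattices.ARMachine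
  Literature.Algebra.EuclideanLattices.FarCertMachine

/-! ### The inner pre- and post-processors -/

/-- **The query extractor** of copy `j`: the `DGS` query of the instance, `queryF x` on `⟨x, eⱼ⟩`.
[cite: Regev2009, Lemma 3.20 (proof: the oracle is called on (L*, 1/(100d)))] -/
def qIn : List Bool → List Bool := RegevQuery.queryF ∘ fstF

/-- **The inner post-processor** on `⟨⟨x, eⱼ⟩, y⟩`: the raw vector code `fstF y` of the sampler's
output, framed: `⟨fstF y, ε⟩`. [folklore] -/
def gIn : List Bool → List Bool := fanoutFn (fstF ∘ sndF) fun _ => []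

/-- `qIn ∈ FP`. [cite: AroraBarak2009, §1.3] -/
theorem qIn_mem_FP : qIn ∈ FP := comp_mem_FP RegevQuery.queryF_mem_FP fstF_mem_FP

/-- `gIn ∈ FP`. [folklore] -/
theorem gIn_mem_FP : gIn ∈ FP := fanoutFn_mem_FP (comp_mem_FP fstF_mem_FP sndF_mem_FP) (const_mem_FP _)

/-- `qIn ⟨x, e⟩ = queryF x`. [folklore] -/
theorem qIn_apply (x e : List Bool) : qIn (boolPair x e) = RegevQuery.queryF x := by simp [qIn]

/-- `gIn ⟨x', y⟩ = ⟨fstF y, ε⟩`. [folklore] -/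
theorem gIn_apply (x' y : List Bool) : gIn (boolPair x' y) = boolPair (fstF y) [] := by simp [gIn]

/-- **Framed codes are read back whatever follows**: `fstF (⟨c, ε⟩ ++ s) = c`. [folklore] -/
theorem fstF_frame_append (c s : List Bool) : fstF (boolPair c [] ++ s) = c := by
  rw [← hOut_apply, hOut_append, fstF_boolPair]

/-- A string with the framed prefix `⟨c, ε⟩` reads `c`. [folklore] -/
theorem fstF_eq_of_prefix {c w : List Bool} (h : boolPair c [] <+: w) : fstF w = c := by
  obtain ⟨s, rfl⟩ := h
  exact fstF_frame_append c s

/-! ### The block reader -/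

variable (P : PolyCopies.Params)

/-- The yardstick polynomial of the block reader: `3000 (X + 1)⁴ + b + K` at the length of `⟨x, ε⟩`
(dominates `N = nSamples n`, the block width and the copy count). [folklore] -/
def ydBPoly : Polynomial ℕ := C 3000 * (X + C 1) ^ 4 + PolyCopiesIdx.bPoly P + PolyCopiesIdx.KPoly P

/-- The yardstick on `z = ⟨x, Y⟩`. [folklore] -/
def ydB : List Bool → List Bool := polyFn (ydBPoly P) ∘ hOut ∘ fstF
/-- `1ᵇ`, `b` the block width at the length of `⟨x, ε⟩`. [folklore] -/
def bU : List Bool → List Bool := polyFn (PolyCopiesIdx.bPoly P) ∘ hOut ∘ fstF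
/-- `Y` after its first `base` bits. [folklore] -/
def restF : List Bool → List Bool := dropFn ∘ fanoutFn (polyFn (PolyCopiesIdx.basePoly P) ∘ hOut ∘ fstF) sndF
/-- `idxList N`. [folklore] -/
def idxNB : List Bool → List Bool := iotaF ∘ fanoutFn (ydB P) nNF

/-- The block item on `⟨yd, ⟨⟨1ᵇ, rest⟩, 1ʲ⟩⟩`: `fstF` of the `j`-th `b`-bit chunk of `rest` (`chunkF`,
with `1ᵇ` clipped to the yardstick so that the item is absolutely bounded). [folklore] -/
def bItem : List Bool → List Bool :=
  fstF ∘ chunkF ∘ fanoutFn (nthF 0) (fanoutFn (takeFn ∘ fanoutFn (nthF 0) (fstF ∘ nthF 1))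
    (fanoutFn (lenBinF ∘ sndPow 1) (sndF ∘ nthF 1)))

/-- **The block reader** on `z = ⟨x, Y⟩`: the coded list of `fstF (chunk j)`, `j < N`.
[cite: Regev2009, Lemma 3.20 (proof: the N samples)] -/
def blocksF : List Bool → List Bool :=
  mapLF bItem ∘ fanoutFn (ydB P) (fanoutFn nNF (fanoutFn (fanoutFn (bU P) (restF P)) (idxNB P)))

/-- **The outer post-processor**: the verdict of the Aharonov–Regev verifier on the decoded blocks.
[cite: Regev2009, Lemma 3.20 (proof: accept iff 𝒱 rejects)] -/
def gOut : List Bool → List Bool := verdictF ∘ fanoutFn fstF (blocksF P)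

variable {P}

/-! ### Polynomial time -/

/-- `bItem ∈ FP`. [folklore] -/
theorem bItem_mem_FP : bItem ∈ FP :=
  comp_mem_FP fstF_mem_FP (comp_mem_FP chunkF_mem_FP (fanoutFn_mem_FP (nthF_mem_FP 0) (fanoutFn_mem_FP
    (comp_mem_FP takeFn_mem_FP (fanoutFn_mem_FP (nthF_mem_FP 0) (comp_mem_FP fstF_mem_FP (nthF_mem_FP 1))))
    (fanoutFn_mem_FP (comp_mem_FP lenBinF_mem_FP (sndPow_mem_FP 1)) (comp_mem_FP sndF_mem_FP (nthF_mem_FP 1))))))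

/-- `chunkF` outputs at most `|field 1|` bits, on every record. [folklore] -/
theorem length_chunkF_le (w : List Bool) : (chunkF w).length ≤ (nthF 1 w).length := by
  rw [chunkF, Function.comp_apply, fanoutFn_apply, takeFn_boolPair]
  exact List.length_take_le _ _

/-- `bItem` is absolutely bounded: `≤ |yd|`. [folklore] -/
theorem length_bItem_le (yd p a : List Bool) :
    (bItem (boolPair yd (boolPair p a))).length ≤ 0 * a.length + (X : Polynomial ℕ).eval yd.length := by
  rw [bItem, Function.comp_apply, Function.comp_apply, zero_mul, zero_add, eval_X]
  set w := fanoutFn (nthF 0) (fanoutFn (takeFn ∘ fanoutFn (nthF 0) (fstF ∘ nthF 1))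
    (fanoutFn (lenBinF ∘ sndPow 1) (sndF ∘ nthF 1))) (boolPair yd (boolPair p a)) with hw
  have h1 := length_fstF_sndF_le (chunkF w)
  have h2 := length_chunkF_le w
  have h3 : (nthF 1 w).length ≤ yd.length := by
    simp only [hw, fanoutFn_apply, nthF_succ_boolPair, nthF_zero_boolPair, Function.comp_apply, takeFn_boolPair]
    exact List.length_take_le _ _
  omega

/-- `ydB ∈ FP`. [folklore] -/
theorem ydB_mem_FP : ydB P ∈ FP := comp_mem_FP (polyFn_mem_FP _) (comp_mem_FP hOut_mem_FP fstF_mem_FP)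
/-- `bU ∈ FP`. [folklore] -/
theorem bU_mem_FP : bU P ∈ FP := comp_mem_FP (polyFn_mem_FP _) (comp_mem_FP hOut_mem_FP fstF_mem_FP)
/-- `restF ∈ FP`. [folklore] -/
theorem restF_mem_FP : restF P ∈ FP :=
  comp_mem_FP dropFn_mem_FP (fanoutFn_mem_FP (comp_mem_FP (polyFn_mem_FP _) (comp_mem_FP hOut_mem_FP fstF_mem_FP)) sndF_mem_FP)
/-- `idxNB ∈ FP`. [folklore] -/
theorem idxNB_mem_FP : idxNB P ∈ FP := comp_mem_FP iotaF_mem_FP (fanoutFn_mem_FP ydB_mem_FP nNF_mem_FP)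
/-- **`blocksF ∈ FP`.** [cite: AroraBarak2009, §1.3] -/
theorem blocksF_mem_FP : blocksF P ∈ FP :=
  comp_mem_FP (mapLF_mem_FP bItem_mem_FP (w := 0) (by norm_num) length_bItem_le)
    (fanoutFn_mem_FP ydB_mem_FP (fanoutFn_mem_FP nNF_mem_FP (fanoutFn_mem_FP (fanoutFn_mem_FP bU_mem_FP restF_mem_FP) idxNB_mem_FP)))
/-- **`gOut ∈ FP`**: the post-processing of Lemma 3.20 is polynomial time.
[cite: Regev2009, Lemma 3.20 ("a polynomial time reduction")] -/
theorem gOut_mem_FP : gOut P ∈ FP := comp_mem_FP verdictF_mem_FP (fanoutFn_mem_FP fstF_mem_FP blocksF_mem_FP)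

/-! ### Values -/

/-- Semantics of `bItem` (`b, j ≤ |yd|`). [folklore] -/
theorem bItem_apply (yd rest : List Bool) {b j : ℕ} (hb : b ≤ yd.length) (hj : j ≤ yd.length) :
    bItem (boolPair yd (boolPair (boolPair (ones b) rest) (ones j))) = fstF ((rest.drop (b * j)).take b) := by
  have htake : (ones b).take yd.length = ones b := List.take_of_length_le (by rw [ones, List.length_replicate]; exact hb)
  have hlen : (ones j).length = j := by rw [ones, List.length_replicate]
  simp only [bItem, Function.comp_apply, fanoutFn_apply, nthF_zero_boolPair, nthF_succ_boolPair, sndPow_succ_boolPair,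
    sndPow_zero, sndF_boolPair, fstF_boolPair, takeFn_boolPair, lenBinF_apply, htake, hlen]
  rw [chunkF_apply, bitsToNat_encodeNat, min_eq_left hj]

/-- `nNF` reads `bin N` off any record whose first component is the instance code. [folklore] -/
theorem nNF_pair (I : LatticeInstance) (t : Fin I.n → ℤ) (d : ℚ) (y : List Bool) :
    nNF (boolPair (codeOf I t d) y) = encodeNat (ARVerifier.nSamples I.n) := by
  have h1 : bitsToNat [true] = 1 := by simp [bitsToNat]
  rw [nNF, Function.comp_apply, fanoutFn_apply]
  simp only [n4F, n2F, n1F, Function.comp_apply, fanoutFn_apply, ncW_input, addFn_boolPair, bitsToNat_encodeNat, h1,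
    prodFn_boolPair, ARVerifier.nSamples]
  congr 1; ring

section Value

variable (P) (I : LatticeInstance) (t : Fin I.n → ℤ) (d : ℚ) (Y : List Bool)

/-- The length `n' = |⟨x, ε⟩|` of the input of the copies. [folklore] -/
def nIn0 : ℕ := (hOut (codeOf I t d)).length

/-- The `j`-th raw code read off the measured string `Y`: `fstF` of the `b`-bit window of block `j`.
[cite: Regev2009, Lemma 3.20 (proof: the j-th sample)] -/
def blockStr (j : ℕ) : List Bool :=
  fstF (((Y.drop (PolyCopiesIdx.base P (nIn0 I t d))).drop (PolyCopiesIdx.b P (nIn0 I t d) * j)).take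
    (PolyCopiesIdx.b P (nIn0 I t d)))

/-- **The decoded sample vectors** `vⱼ = decodeIntVec n (blockStr j)`, `j < N`.
[cite: Regev2009, Lemma 3.20 (proof: the samples w₁, …, w_N)] -/
def vecOf : Fin (ARVerifier.nSamples I.n) → Fin I.n → ℤ := fun j => decodeIntVec I.n (blockStr P I t d Y j)

/-- `n ≤ n'`. [folklore] -/
theorem n_le_nIn0 : I.n ≤ nIn0 I t d := by
  rw [nIn0, hOut_apply, length_boolPair]
  have := RegevQuery.n_le_length_codeOf I t d
  omega

/-- The yardstick length: `3000 (n'+1)⁴ + b + K`. [folklore] -/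
theorem length_ydB : (ydB P (boolPair (codeOf I t d) Y)).length =
    3000 * (nIn0 I t d + 1) ^ 4 + PolyCopiesIdx.b P (nIn0 I t d) + PolyCopiesIdx.K P (nIn0 I t d) := by
  simp [ydB, ydBPoly, nIn0, eval_mul, eval_pow, eval_add, eval_X]

/-- `N ≤ |yd|`. [folklore] -/
theorem nSamples_le_ydB : ARVerifier.nSamples I.n ≤ (ydB P (boolPair (codeOf I t d) Y)).length := by
  rw [length_ydB, ARVerifier.nSamples]
  have := Nat.pow_le_pow_left (Nat.succ_le_succ (n_le_nIn0 I t d)) 4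
  nlinarith

/-- **`blocksF` on `⟨x, Y⟩`**: the coded list of the `N` raw codes `blockStr j`. [cite: Regev2009, Lemma 3.20 (proof)] -/
theorem blocksF_apply : blocksF P (boolPair (codeOf I t d) Y) =
    encList ((List.range (ARVerifier.nSamples I.n)).map fun j => blockStr P I t d Y j) := by
  have hN := nSamples_le_ydB (P := P) I t d Y
  have hyd := length_ydB (P := P) I t d Y
  rw [blocksF, Function.comp_apply]
  simp only [fanoutFn_apply, idxNB, Function.comp_apply, nNF_pair, iotaF_apply _ hN]
  rw [mapLF_idxList _ _ _ hN]
  refine congrArg encList (List.map_congr_left fun j hj => ?_)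
  have hj' : j < ARVerifier.nSamples I.n := List.mem_range.1 hj
  have hb : PolyCopiesIdx.b P (nIn0 I t d) ≤ (ydB P (boolPair (codeOf I t d) Y)).length := by rw [hyd]; omega
  simp only [bU, restF, Function.comp_apply, fanoutFn_apply, fstF_boolPair, sndF_boolPair, polyFn_apply,
    PolyCopiesIdx.eval_bPoly, PolyCopiesIdx.eval_basePoly, dropFn_boolPair, ones, List.length_replicate]
  rw [← ones, ← ones, ← nIn0, bItem_apply _ _ hb (le_of_lt (lt_of_lt_of_le hj' hN)), blockStr]

/-- The list of raw codes has length `N` and entries `blockStr j`. [folklore] -/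
theorem getD_blocks (j : Fin (ARVerifier.nSamples I.n)) :
    ((List.range (ARVerifier.nSamples I.n)).map fun j => blockStr P I t d Y j).getD j [] = blockStr P I t d Y j := by
  rw [List.getD_eq_getElem _ _ (by simp), List.getElem_map, List.getElem_range]

/-- **The outer post-processor accepts iff the verifier rejects the decoded blocks** (`n ≥ 1`).
[cite: Regev2009, Lemma 3.20 (proof, p. 22: accept iff 𝒱 rejects)] -/
theorem gOut_eq_true_iff (hn : 1 ≤ I.n) :
    gOut P (boolPair (codeOf I t d) Y) = [true] ↔ ¬ ARVerifier.MAccepts I.basis t d (vecOf P I t d Y) := by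
  rw [gOut, Function.comp_apply, fanoutFn_apply, fstF_boolPair, blocksF_apply,
    verdictF_eq_true_iff I t d _ hn (by rw [List.length_map, List.length_range])]
  simp only [getD_blocks]
  rfl

/-- **… and rejects iff the verifier accepts.** [cite: Regev2009, Lemma 3.20 (proof, p. 22)] -/
theorem gOut_eq_false_iff (hn : 1 ≤ I.n) :
    gOut P (boolPair (codeOf I t d) Y) = [false] ↔ ARVerifier.MAccepts I.basis t d (vecOf P I t d Y) := by
  rw [gOut, Function.comp_apply, fanoutFn_apply, fstF_boolPair, blocksF_apply,
    verdictF_eq_false_iff I t d _ hn (by rw [List.length_map, List.length_range])]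
  simp only [getD_blocks]
  rfl

end Value

end Lemma320

end Regev2009

end Literature.Computability.Cryptography

end
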